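/-
Copyright (c) 2026 the pub-hodgecm-mathlib formalisation cell (harness21).  Prover seat hodgecm-mathlib-LH4-p01 (g12): road M6 → F5 → dyadic chain of `stub_DyUnramCore` (D-UNR),
site (L2-3) «THE WALL», the FOUR-SCALAR Möbius kit under the CM-carrier rows 1∕3∕5 and (A3) of CENSUS-L23-CM v1 (LH10-p01 (g12)); 2026-09-03.
-/
import Literature.NumberTheory.Automorphic.MatrixMoebiusShiftInverse     -- ★ p846466 (F0P2-p02): the symmetric-pair inverse shift `ψ ∘ φ = id`, `smul_conj_add_smul_one`, `det_smul_conj_add_smul_one` (pattern); brings ★ α `MatrixMoebiusShift` (`smul_add_smul_one_mulVec_of_eigenvector`)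
import HarnessLib

/-!
# The Möbius shift with FOUR scalars `φ(M) = (a·M + b·1)(b′·M + a′·1)⁻¹` over a commutative ring: blocks, `reindex`, ring maps, eigenvectors, `1 × 1`, and the inverse shift
# `ψ = φ_{a′, −b ∣ −b′, a}` (Weyl 1939 II §10; Horn–Johnson §0.8)

Topic `NumberTheory/Automorphic`; namespace `Literature.NumberTheory.Automorphic.MoebiusShift`.  THEOREMS ONLY (no definition, no instance, no notation, no named fact, no `sorry`);
kernel lane `--supports stmt-HodgeConjecture-24833`.  Cell `pub/hodgecm-mathlib` (D-0151), crux H413 = `stmt-HodgeConjecture-24833`; road M6 → F5 → the dyadic chain of organ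
(D-UNR) `stub_DyUnramCore`, LEVEL TWO, site (L2-3) «THE WALL» (★ `liftInterior_of_levelTwo` minus `h2`).  ★ α `MatrixMoebiusShift` ∕ ★ `MatrixMoebiusShiftInverse` state the
carrier-level algebra of the Cayley shift for the SYMMETRIC pair `(a, b ∣ b, a)` — enough for the σ-fixed shift `(c+1, c−1)` of the `v ∤ 2` road.  The 2-free road (LH10-p01
(g12) MEMO-L23-θSHIFT, P1–P4 ★) uses the HERMITIAN pair `(θ, c−θ ∣ c−σθ, σθ)`, which is NOT symmetric; this file restates the symmetric-pair lemmas consumed by the CM-carrier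
layer (★ `TypeTwoCayleyShiftCM` §1–§2, ★ N5b, ★ (A3) `FinExplicitTransferFactorCayleyShiftSum`) for four arbitrary scalars `(a, b ∣ b′, a′)`, with the SAME proofs.  Pure
matrix algebra over a commutative ring; count-neutral.
HONEST LABEL: HC_CM is proved only modulo the 7 printed citations (2 remaining: hLiu418 = stmt-HodgeConjecture-24832, h413 = stmt-HodgeConjecture-24833) until rung 0 closes.

* §1 `genMoebius_reindex`, `genMoebius_fromBlocks`, `map_genMoebius` (ring maps; ★ `map_nonsing_inv_of_isUnit` inlined), `genMoebius_mulVec_of_eigenvector_ring`, `genMoebius_fin_one_apply`;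
* §2 the inverse shift: `neg_smul_genMoebius_add_smul_one` (`(−b′)φ(M) + a = Δ•D⁻¹`), `smul_genMoebius_add_neg_smul_one` (`a′φ(M) − b = Δ•M·D⁻¹`), `Δ = aa′ − bb′`,
  **`genMoebius_neg_genMoebius`** (`ψ(φ M) = M` for `Δ` a unit), `isUnit_det_neg_smul_genMoebius_add_smul_one`, `isUnit_det_genMoebius`.
(Conjugation equivariance with four scalars is ★ P1 `moebius_conj'`; `det(z•PMP⁻¹ + w•1) = det(z•M + w•1)` is ★ `det_smul_conj_add_smul_one`, scalar-generic already.)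

## References
* [Weyl1939] H. Weyl, *The Classical Groups* (1939): Chap. II §10 (Cayley's rational parametrisation).
* [HornJohnson2013] R. A. Horn, C. R. Johnson, *Matrix Analysis*, 2nd ed. (2013): §0.8.2, §1.1, §2.1.
* [Kottwitz1986BaseChangeUnits] R. E. Kottwitz, *Base change for unit elements of Hecke algebras*, Compositio Math. 60 (1986): §3.
-/

set_option autoImplicit false

open Matrix

namespace Literature.NumberTheory.Automorphic.MoebiusShift

variable {R : Type*} [CommRing R] {n : Type*} [Fintype n] [DecidableEq n]

/-! ## §1 Blocks, `reindex`, ring maps, eigenvectors, `1 × 1` -/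

/-- **`reindex` equivariance, four scalars**: `φ(reindex e e M) = reindex e e (φ M)`. [cite: HornJohnson2013, §0.8.2] -/
theorem genMoebius_reindex {m : Type*} [Fintype m] [DecidableEq m] (e : n ≃ m) (M : Matrix n n R) (a b a' b' : R) :
    (a • reindex e e M + b • (1 : Matrix m m R)) * (b' • reindex e e M + a' • (1 : Matrix m m R))⁻¹ =
      reindex e e ((a • M + b • 1) * (b' • M + a' • 1)⁻¹) := by
  have h1 : ∀ x y : R, x • reindex e e M + y • (1 : Matrix m m R) = reindex e e (x • M + y • 1) := fun x y => by
    ext i j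
    simp [Matrix.reindex_apply, Matrix.one_apply]
  have h2 : ∀ A B : Matrix n n R, reindex e e A * reindex e e B = reindex e e (A * B) := fun A B => by
    simp only [Matrix.reindex_apply]
    exact Matrix.submatrix_mul_equiv A B e.symm e.symm e.symm
  rw [h1, h1, Matrix.inv_reindex, h2]

/-- **Block-diagonal compatibility, four scalars**: `φ(A ⊕ B) = φ(A) ⊕ φ(B)` when both denominators are invertible. [cite: HornJohnson2013, §0.8.2] -/
theorem genMoebius_fromBlocks {m : Type*} [Fintype m] [DecidableEq m] (A : Matrix n n R) (B : Matrix m m R) (a b a' b' : R)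
    (hA : IsUnit (b' • A + a' • (1 : Matrix n n R)).det) (hB : IsUnit (b' • B + a' • (1 : Matrix m m R)).det) :
    (a • fromBlocks A 0 0 B + b • (1 : Matrix (n ⊕ m) (n ⊕ m) R)) * (b' • fromBlocks A 0 0 B + a' • (1 : Matrix (n ⊕ m) (n ⊕ m) R))⁻¹ =
      fromBlocks ((a • A + b • 1) * (b' • A + a' • 1)⁻¹) 0 0 ((a • B + b • 1) * (b' • B + a' • 1)⁻¹) := by
  have h1 : ∀ x y : R, x • fromBlocks A 0 0 B + y • (1 : Matrix (n ⊕ m) (n ⊕ m) R) = fromBlocks (x • A + y • 1) 0 0 (x • B + y • 1) := fun x y => by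
    rw [← Matrix.fromBlocks_one, Matrix.fromBlocks_smul, Matrix.fromBlocks_smul, Matrix.fromBlocks_add]
    simp only [smul_zero, add_zero]
  have hinv : (fromBlocks (b' • A + a' • 1) 0 0 (b' • B + a' • 1))⁻¹ = fromBlocks (b' • A + a' • 1)⁻¹ 0 0 (b' • B + a' • 1)⁻¹ := by
    refine Matrix.inv_eq_right_inv ?_
    rw [Matrix.fromBlocks_multiply]
    simp [Matrix.mul_nonsing_inv _ hA, Matrix.mul_nonsing_inv _ hB, Matrix.fromBlocks_one]
  rw [h1, h1, hinv, Matrix.fromBlocks_multiply]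
  simp

/-- **Four-scalar transport of a Möbius quotient along a ring map**: `((aM + b)(b′M + a′)⁻¹).map f = (f a·M^f + f b)(f b′·M^f + f a′)⁻¹` when the denominator is invertible
(★ `map_moebius` is the symmetric pair). [cite: Weyl1939, Chap. II §10] [cite: HornJohnson2013, §0.8.2] -/
theorem map_genMoebius {S : Type*} [CommRing S] (f : R →+* S) (M : Matrix n n R) (a b a' b' : R) (hD : IsUnit (b' • M + a' • (1 : Matrix n n R)).det) :
    ((a • M + b • (1 : Matrix n n R)) * (b' • M + a' • (1 : Matrix n n R))⁻¹).map f =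
      (f a • M.map f + f b • (1 : Matrix n n S)) * (f b' • M.map f + f a' • (1 : Matrix n n S))⁻¹ := by
  have hlin : ∀ x y : R, (x • M + y • (1 : Matrix n n R)).map f = f x • M.map f + f y • (1 : Matrix n n S) := fun x y => by
    ext i j; simp [Matrix.map_apply, Matrix.one_apply, apply_ite f]
  -- `(D⁻¹).map f = (D.map f)⁻¹` (★ `map_nonsing_inv_of_isUnit`, inlined to keep this file import-light)
  have hinv : ((b' • M + a' • (1 : Matrix n n R))⁻¹).map f = ((b' • M + a' • (1 : Matrix n n R)).map f)⁻¹ := by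
    refine (Matrix.inv_eq_right_inv ?_).symm
    rw [← Matrix.map_mul, Matrix.mul_nonsing_inv _ hD, Matrix.map_one f (map_zero f) (map_one f)]
  rw [Matrix.map_mul, hinv, hlin, hlin]

/-- **The ring form of the eigenvector rule, four scalars**: `Mp = μp`, `b′μ + a′` a unit, `det(b′M + a′)` a unit ⇒ `φ(M)p = ((aμ + b)·(b′μ + a′)⁻¹)p` with `Ring.inverse`.
[cite: HornJohnson2013, §1.1] [cite: Kottwitz1986BaseChangeUnits, §3] -/
theorem genMoebius_mulVec_of_eigenvector_ring {M : Matrix n n R} {p : n → R} {μ : R} (hp : M *ᵥ p = μ • p) (a b a' b' : R) (hμ : IsUnit (b' * μ + a'))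
    (hD : IsUnit (b' • M + a' • (1 : Matrix n n R)).det) :
    ((a • M + b • (1 : Matrix n n R)) * (b' • M + a' • (1 : Matrix n n R))⁻¹) *ᵥ p = ((a * μ + b) * Ring.inverse (b' * μ + a')) • p := by
  have h2 : (b' * μ + a') • ((b' • M + a' • (1 : Matrix n n R))⁻¹ *ᵥ p) = p := by
    have h3 : (b' • M + a' • (1 : Matrix n n R))⁻¹ *ᵥ ((b' • M + a' • (1 : Matrix n n R)) *ᵥ p) = p := by
      rw [Matrix.mulVec_mulVec, Matrix.nonsing_inv_mul _ hD, Matrix.one_mulVec]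
    rwa [smul_add_smul_one_mulVec_of_eigenvector hp, Matrix.mulVec_smul] at h3
  have h1 : (b' • M + a' • (1 : Matrix n n R))⁻¹ *ᵥ p = Ring.inverse (b' * μ + a') • p := by
    calc (b' • M + a' • (1 : Matrix n n R))⁻¹ *ᵥ p = Ring.inverse (b' * μ + a') • ((b' * μ + a') • ((b' • M + a' • (1 : Matrix n n R))⁻¹ *ᵥ p)) := by
          rw [smul_smul, Ring.inverse_mul_cancel _ hμ, one_smul]
      _ = Ring.inverse (b' * μ + a') • p := by rw [h2]
  rw [← Matrix.mulVec_mulVec, h1, Matrix.mulVec_smul, smul_add_smul_one_mulVec_of_eigenvector hp, smul_smul, mul_comm]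

omit [Fintype n] [DecidableEq n] in
/-- The four-scalar shift of a `1 × 1` matrix `(u)`: its entry is `(au + b)·(b′u + a′)⁻¹` (`Ring.inverse`). [cite: Kottwitz1986BaseChangeUnits, §3] -/
theorem genMoebius_fin_one_apply (U : Matrix (Fin 1) (Fin 1) R) (a b a' b' : R) :
    ((a • U + b • (1 : Matrix (Fin 1) (Fin 1) R)) * (b' • U + a' • (1 : Matrix (Fin 1) (Fin 1) R))⁻¹) 0 0 = (a * U 0 0 + b) * Ring.inverse (b' * U 0 0 + a') := by
  rw [Matrix.inv_def, Matrix.adjugate_fin_one, Matrix.det_fin_one, Matrix.mul_smul, Matrix.mul_one, Matrix.smul_apply, smul_eq_mul, mul_comm]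
  simp

/-! ## §2 The inverse shift `ψ = φ_{a′, −b ∣ −b′, a}`: `ψ(φ M) = M` when `Δ = aa′ − bb′` is a unit -/

/-- **The `ψ`-denominator of `φ(M)`**: `(−b′)•φ(M) + a•1 = (aa′ − bb′)•(b′•M + a′•1)⁻¹`. [cite: Weyl1939, Chap. II §10] -/
theorem neg_smul_genMoebius_add_smul_one (M : Matrix n n R) (a b a' b' : R) (hD : IsUnit (b' • M + a' • (1 : Matrix n n R)).det) :
    (-b') • ((a • M + b • (1 : Matrix n n R)) * (b' • M + a' • (1 : Matrix n n R))⁻¹) + a • (1 : Matrix n n R) =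
      (a * a' - b * b') • (b' • M + a' • (1 : Matrix n n R))⁻¹ := by
  set D : Matrix n n R := b' • M + a' • 1 with hDdef
  have h1 : D * D⁻¹ = 1 := Matrix.mul_nonsing_inv D hD
  have key : (-b') • (a • M + b • (1 : Matrix n n R)) + a • D = (a * a' - b * b') • (1 : Matrix n n R) := by
    rw [hDdef, smul_add, smul_add, smul_smul, smul_smul, smul_smul, smul_smul]
    module
  have e1 : ((-b') • (a • M + b • (1 : Matrix n n R)) + a • D) * D⁻¹ = (-b') • ((a • M + b • (1 : Matrix n n R)) * D⁻¹) + a • (1 : Matrix n n R) := by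
    rw [add_mul, smul_mul_assoc, smul_mul_assoc, h1]
  rw [← e1, key, smul_mul_assoc, Matrix.one_mul]

/-- **The `ψ`-numerator of `φ(M)`**: `a′•φ(M) + (−b)•1 = (aa′ − bb′)•(M·(b′•M + a′•1)⁻¹)`. [cite: Weyl1939, Chap. II §10] -/
theorem smul_genMoebius_add_neg_smul_one (M : Matrix n n R) (a b a' b' : R) (hD : IsUnit (b' • M + a' • (1 : Matrix n n R)).det) :
    a' • ((a • M + b • (1 : Matrix n n R)) * (b' • M + a' • (1 : Matrix n n R))⁻¹) + (-b) • (1 : Matrix n n R) =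
      (a * a' - b * b') • (M * (b' • M + a' • (1 : Matrix n n R))⁻¹) := by
  set D : Matrix n n R := b' • M + a' • 1 with hDdef
  have h1 : D * D⁻¹ = 1 := Matrix.mul_nonsing_inv D hD
  have key : a' • (a • M + b • (1 : Matrix n n R)) + (-b) • D = (a * a' - b * b') • M := by
    rw [hDdef, smul_add, smul_add, smul_smul, smul_smul, smul_smul, smul_smul]
    module
  have e1 : (a' • (a • M + b • (1 : Matrix n n R)) + (-b) • D) * D⁻¹ = a' • ((a • M + b • (1 : Matrix n n R)) * D⁻¹) + (-b) • (1 : Matrix n n R) := by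
    rw [add_mul, smul_mul_assoc, smul_mul_assoc, h1]
  rw [← e1, key, smul_mul_assoc]

/-- **THE INVERSE SHIFT, four scalars: `ψ(φ(M)) = M`** with `ψ = φ_{a′, −b ∣ −b′, a}`, whenever `Δ = aa′ − bb′` and `det(b′•M + a′•1)` are units (★ `moebius_neg_moebius` is the
symmetric pair, `Δ = a² − b²`; for the hermitian pair `(θ, c−θ ∣ c−σθ, σθ)`, `Δ = θσθ − (c−θ)(c−σθ) = c(1−c)`, ★ P2 `hermitianPair_key_scalar`). [cite: Weyl1939, Chap. II §10]
[cite: Kottwitz1986BaseChangeUnits, §3] -/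
theorem genMoebius_neg_genMoebius (M : Matrix n n R) {a b a' b' : R} (hΔ : IsUnit (a * a' - b * b')) (hD : IsUnit (b' • M + a' • (1 : Matrix n n R)).det) :
    (a' • ((a • M + b • (1 : Matrix n n R)) * (b' • M + a' • (1 : Matrix n n R))⁻¹) + (-b) • (1 : Matrix n n R)) *
        ((-b') • ((a • M + b • (1 : Matrix n n R)) * (b' • M + a' • (1 : Matrix n n R))⁻¹) + a • (1 : Matrix n n R))⁻¹ = M := by
  set D : Matrix n n R := b' • M + a' • 1 with hDdef
  rw [smul_genMoebius_add_neg_smul_one M a b a' b' hD, neg_smul_genMoebius_add_smul_one M a b a' b' hD]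
  obtain ⟨k, hk⟩ := hΔ
  have hinv : ((a * a' - b * b') • D⁻¹)⁻¹ = (↑k⁻¹ : R) • D := by
    refine Matrix.inv_eq_right_inv ?_
    rw [smul_mul_assoc, mul_smul_comm, smul_smul, Matrix.nonsing_inv_mul D hD, ← hk, Units.mul_inv, one_smul]
  rw [hinv, smul_mul_assoc, mul_smul_comm, smul_smul, Matrix.mul_assoc, Matrix.nonsing_inv_mul D hD, Matrix.mul_one, ← hk, Units.mul_inv, one_smul]

/-- The `ψ`-denominator of `φ(M)` has UNIT determinant (`= Δ^n · det(b′•M + a′•1)⁻¹`). [cite: Weyl1939, Chap. II §10] -/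
theorem isUnit_det_neg_smul_genMoebius_add_smul_one (M : Matrix n n R) {a b a' b' : R} (hΔ : IsUnit (a * a' - b * b'))
    (hD : IsUnit (b' • M + a' • (1 : Matrix n n R)).det) :
    IsUnit ((-b') • ((a • M + b • (1 : Matrix n n R)) * (b' • M + a' • (1 : Matrix n n R))⁻¹) + a • (1 : Matrix n n R)).det := by
  rw [neg_smul_genMoebius_add_smul_one M a b a' b' hD, Matrix.det_smul]
  exact (hΔ.pow _).mul ((Matrix.isUnit_nonsing_inv_det_iff (A := b' • M + a' • (1 : Matrix n n R))).2 hD)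

/-- **`det φ(M)` is a unit** when the numerator and denominator determinants are (four scalars). [cite: HornJohnson2013, §0.8.2] -/
theorem isUnit_det_genMoebius {M : Matrix n n R} {a b a' b' : R} (hN : IsUnit (a • M + b • (1 : Matrix n n R)).det) (hD : IsUnit (b' • M + a' • (1 : Matrix n n R)).det) :
    IsUnit ((a • M + b • (1 : Matrix n n R)) * (b' • M + a' • (1 : Matrix n n R))⁻¹).det := by
  rw [Matrix.det_mul]
  exact hN.mul ((Matrix.isUnit_nonsing_inv_det_iff (A := b' • M + a' • (1 : Matrix n n R))).2 hD)

end Literature.NumberTheory.Automorphic.MoebiusShift
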